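import Literature.AnabelianGeometry.EtaleTheta.SettingModelChiCyclotomes
import Literature.AnabelianGeometry.EtaleTheta.SettingModelChiGroupLevelHolds
import Literature.AnabelianGeometry.EtaleTheta.Discharge.Sec1ThetaCompactOfYcl
import HarnessLib

/-!
# The χ-twisted root model `ThetaSetting.modelχ p` of [EtTh] §1 (R78): η′ + (R3) + `hYcl` ⇒ the TOPOLOGICAL root data
# — `(Π^tp_X)^Θ`, `(Π^tp_X)^ell` Hausdorff, `Δ_Θ` and `(Δ^tp_Y)^Θ` COMPACT (profinite), all unconditional (proof-only)

Mochizuki, *The étale theta function …*, Publ. RIMS **45** (2009) [EtTh], §1, PRIMS p. 238 («we have a natural exact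
sequence of abelian profinite groups `1 → Δ_Θ → (Δ^tp_Y)^Θ → (Δ^tp_Y)^ell → 1`») [cite: MochizukiEtTh2009, §1 p.12];
*Semi-graphs of anabelioids* [SemiAnbd], Ex. 3.10 pp. 43–45 [cite: MochizukiSemiAnbd2006, Ex 3.10 p.45].  abc-iut cell,
seat abc-iut-w5-d111 (gen 4); R78 cluster, consumer side of F5b.  PROOF-ONLY (0 definitions, 0 instances): at
abc-iut-L2-t1's `ThetaSetting.modelχ p` (SettingModelChiTheta p433524: root over abc-iut-w5-d249's `curveχ p`
with `hYcl_modelχ`; reached through abc-iut-L2-t8's SettingModelChiCyclotomes), combine this seat's UNCONDITIONAL `GroupLevelData (curveχ p)` (SettingModelChiGroupLevelHolds) with the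
gen-3 reductions of `Sec1ThetaCompactOfYcl` (GAP-LEDGER D-G-w5d187-1 «hΔ ⟸ hYcl + R3 + η′»):

* `nonempty_groupLevelData_modelχ`, `isTempered_piTemp_modelχ`, `secondCountableTopology_piTemp_modelχ` — η′ at `modelχ`;
* `isQuotientMap_toTheta_modelχ`, `isQuotientMap_thetaToEll_modelχ` — (R3) HOLDS at `modelχ` (the theta quotients of
  abc-iut-L2-d1's `CurveTheta` package are quotient groups with the quotient topology);
* `t2Space_gtpEll_modelχ`, `isClosed_deltaTheta_modelχ` — `(Π^tp_X)^ell` Hausdorff, `Δ_Θ` closed (`(Π^tp_X)^Θ`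
  Hausdorff and `Δ_Θ` compact are abc-iut-L2-t8's `CurveTheta.t2Space_GTheta` / `isCompact_deltaTheta_modelχ`,
  SettingModelChiCyclotomes p433637 — imported, not restated);
* **`isCompact_dtpYTheta_modelχ`** — `(Δ^tp_Y)^Θ` is COMPACT («`1 → Δ_Θ → (Δ^tp_Y)^Θ → (Δ^tp_Y)^ell → 1` … abelian
  PROFINITE groups», p. 238) at the χ-model, by this seat's `isCompact_dtpYTheta_of_groupLevelData` (p425959) at the
  unconditional bundle + `hYcl_modelχ`; `compactSpace_deltaTheta_modelχ`; `hDelta_modelχ` = the binder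
  `hΔ : IsCompact Δ_Θ ∧ T2Space (Π^tp_X)^Θ` of GAP-LEDGER G-w5d187-1 (consumers `IotaInvariantThetaInfty*`, the
  `CyclotomeTower` chain) packaged at `modelχ`.
HONEST LABEL: semi-synthetic model (not the tempered `π₁` of a curve) — consistency evidence only; classical topological
group theory; nothing of [EtTh]/[SemiAnbd] asserted; no side taken on [IUTchIII] Cor. 3.12.
-/

noncomputable section

namespace Literature.AnabelianGeometry.EtaleTheta.SettingModel

open Literature.AnabelianGeometry.SemiGraphs Literature.AlgebraicGeometry.Frobenioids _root_.Topology

variable (p : ℕ) [Fact p.Prime]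

/-! ### η′ at `modelχ` (its tempered-curve layer IS `curveχ`) -/

/-- abc-iut-L3's parameter bundle at the tempered-curve layer of `modelχ` (= `curveχ p` by construction).
[cite: MochizukiSemiAnbd2006, Ex 3.10 p.45] -/
theorem nonempty_groupLevelData_modelχ :
    Nonempty (TemperedCurve.GroupLevelData (ThetaSetting.modelχ p).toTemperedCurve) :=
  nonempty_groupLevelData_curveχ_holds p

/-- `Π^tp_X` of `modelχ` is tempered. [cite: MochizukiSemiAnbd2006, Ex 3.10 p.43] -/
theorem isTempered_piTemp_modelχ : IsTempered (ThetaSetting.modelχ p).PiTemp :=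
  isTempered_PiTpχ p

/-- `Π^tp_X` of `modelχ` is Galois-countable (second countable; in particular first countable).
[cite: MochizukiSemiAnbd2006, Ex 3.10 p.43] -/
theorem secondCountableTopology_piTemp_modelχ : SecondCountableTopology (ThetaSetting.modelχ p).PiTemp :=
  secondCountableTopology_PiTpχ p

/-! ### (R3) at `modelχ`: the theta quotients are quotient maps -/

/-- **(R3), first half, at `modelχ`**: `Π^tp_X ↠ (Π^tp_X)^Θ` is a quotient map (it is `QuotientGroup.mk'` of
abc-iut-L2-d1's `CurveTheta.thetaKer`). [cite: MochizukiEtTh2009, §1 p.12] -/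
theorem isQuotientMap_toTheta_modelχ : IsQuotientMap (ThetaSetting.modelχ p).toTheta :=
  QuotientGroup.isQuotientMap_mk (CurveTheta.thetaKer (curveχ p))

/-- **(R3), second half, at `modelχ`**: `(Π^tp_X)^Θ ↠ (Π^tp_X)^ell` is a quotient map (its composite with the first
quotient map is the quotient map `Π^tp_X ↠ Π^tp_X / ellKer`). [cite: MochizukiEtTh2009, §1 p.12] -/
theorem isQuotientMap_thetaToEll_modelχ : IsQuotientMap (ThetaSetting.modelχ p).thetaToEll := by
  have hcomp : ((ThetaSetting.modelχ p).thetaToEll ∘ (ThetaSetting.modelχ p).toTheta :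
      (ThetaSetting.modelχ p).PiTemp → (ThetaSetting.modelχ p).GtpEll) =
        (QuotientGroup.mk' (CurveTheta.ellKer (curveχ p)) : PiTpχ p → CurveTheta.GEll (curveχ p)) := by
    have h := CurveTheta.thetaToEll_comp (curveχ p)
    exact congrArg (fun f : PiTpχ p →* CurveTheta.GEll (curveχ p) => (f : PiTpχ p → CurveTheta.GEll (curveχ p))) h
  have hq : IsQuotientMap ((ThetaSetting.modelχ p).thetaToEll ∘ (ThetaSetting.modelχ p).toTheta) := by
    rw [hcomp]
    exact QuotientGroup.isQuotientMap_mk (CurveTheta.ellKer (curveχ p))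
  exact IsQuotientMap.of_comp (ThetaSetting.modelχ p).continuous_toTheta (ThetaSetting.modelχ p).continuous_thetaToEll hq

/-! ### Hausdorffness and compactness of the theta-quotient data -/

/-- **`(Π^tp_X)^ell` of `modelχ` is Hausdorff**. [cite: MochizukiEtTh2009, §1 p.12] -/
theorem t2Space_gtpEll_modelχ : T2Space (ThetaSetting.modelχ p).GtpEll :=
  (ThetaSetting.modelχ p).t2Space_gtpEll_of_isQuotientMap (isQuotientMap_toTheta_modelχ p)
    (isQuotientMap_thetaToEll_modelχ p)


/-- `Δ_Θ` of `modelχ` is closed in `(Π^tp_X)^Θ`. [cite: MochizukiEtTh2009, §1 p.12] -/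
theorem isClosed_deltaTheta_modelχ :
    IsClosed (((ThetaSetting.modelχ p).DeltaTheta : Subgroup (ThetaSetting.modelχ p).GtpTheta) :
      Set (ThetaSetting.modelχ p).GtpTheta) :=
  (ThetaSetting.modelχ p).isClosed_deltaTheta_of_isQuotientMap (isQuotientMap_toTheta_modelχ p)
    (isQuotientMap_thetaToEll_modelχ p)

/-- **`(Δ^tp_Y)^Θ` of `modelχ` is COMPACT** («abelian profinite», [EtTh] p. 238). [cite: MochizukiEtTh2009, §1 p.12] -/
theorem isCompact_dtpYTheta_modelχ :
    IsCompact (((ThetaSetting.modelχ p).DtpYTheta : Subgroup (ThetaSetting.modelχ p).GtpTheta) :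
      Set (ThetaSetting.modelχ p).GtpTheta) :=
  (ThetaSetting.modelχ p).isCompact_dtpYTheta_of_groupLevelData (nonempty_groupLevelData_modelχ p).some
    (hYcl_modelχ p)

/-- `Δ_Θ` of `modelχ` is a compact space (subtype form, for instance consumers). [cite: MochizukiEtTh2009, §1 p.12] -/
theorem compactSpace_deltaTheta_modelχ : CompactSpace ↥(ThetaSetting.modelχ p).DeltaTheta :=
  isCompact_iff_compactSpace.mp (isCompact_deltaTheta_modelχ p)

/-- `Δ_Θ` of `modelχ` is compact — second route, recorded as a cross-check of abc-iut-L2-t8's coordinate proof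
(`isCompact_deltaTheta_modelχ`, image of `Ẑ`): this seat's `isCompact_deltaTheta_of_groupLevelData` (p425959, open
mapping / completeness route) at the unconditional bundle + `hYcl_modelχ`. [cite: MochizukiEtTh2009, §1 p.12] -/
example : IsCompact (((ThetaSetting.modelχ p).DeltaTheta : Subgroup (ThetaSetting.modelχ p).GtpTheta) :
    Set (ThetaSetting.modelχ p).GtpTheta) :=
  (ThetaSetting.modelχ p).isCompact_deltaTheta_of_groupLevelData (nonempty_groupLevelData_modelχ p).some
    (hYcl_modelχ p)

/-- **The binder `hΔ` of GAP-LEDGER G-w5d187-1 — «`Δ_Θ` is profinite inside the Hausdorff `(Π^tp_X)^Θ`» — HOLDS at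
`modelχ`** (consumers: `IotaInvariantThetaInfty*`, the `CyclotomeTower` chain). [cite: MochizukiEtTh2009, §1 p.12] -/
theorem hDelta_modelχ :
    IsCompact (((ThetaSetting.modelχ p).DeltaTheta : Subgroup (ThetaSetting.modelχ p).GtpTheta) :
      Set (ThetaSetting.modelχ p).GtpTheta) ∧ T2Space (ThetaSetting.modelχ p).GtpTheta :=
  ⟨isCompact_deltaTheta_modelχ p, CurveTheta.t2Space_GTheta (curveχ p)⟩

end Literature.AnabelianGeometry.EtaleTheta.SettingModel

end
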